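import Mathlib
import HarnessLib
import Summits.Ventures.LatticeQCDFlow.Exactness.SUNJitteredHMCCertificates
import Summits.Ventures.LatticeQCDFlow.Exactness.SUNMetropolisORSweepFiguresOfMerit
import Summits.Ventures.LatticeQCDFlow.Exactness.CabibboMarinariORSweepFiguresOfMerit
import Summits.Ventures.LatticeQCDFlow.Exactness.SUNLeapfrogHMCORSweepFiguresOfMerit
import Summits.Ventures.LatticeQCDFlow.Scoring.ChainEDFBandMinorised

/-!
# Finite-sample bands for the engine's chains as run, from every start (GEN-23, row 9 eng-latcore, 23-17)

NEW WORK of the cell, not a published result; no definition is introduced; nothing is cited as a fact.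
HONEST FRAMING: exact (Metropolis-corrected) sampling algorithms for lattice gauge theory; figures of merit are
autocorrelation/cost numbers at stated couplings and volumes; no continuum-physics claim.

The asymptotic figures of merit of GEN-23 (`τ_int`, CLT, batch means, coverage, `τ̂_int`) say nothing at a FIXED
production length `N`.  Row 8's `Scoring/ChainEDFBandMinorised` proves, for ANY Markov kernel `K` with an invariant
probability `π` and a block Doeblin certificate `ε ν(B) ≤ K^m(x, B)` minorised by an ARBITRARY law `ν`
(`0 < ε ≤ 1`, `0 < m`), from EVERY initial law `μ₀`, at every `N`:
(H) a Hoeffding tail for the time average of a bounded `f`: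
    `P_{μ₀}(s ≤ |A_N f − π(f)|) ≤ 2 exp(−(N s − 4 m (C + |π f|)/ε)² / (8 N m² (C + |π f|)²/ε²))` once
    `N s ≥ 4 m (C + |π f|)/ε`;
(E) a uniform band for the empirical distribution function of any real observable `O` (atoms allowed):
    `P_{μ₀}(∃ t, δ + 1/K ≤ |F_π(t) − F̂_N(t)|) ≤ 4 (K + 1) exp(−(N δ − 8 m/ε)²/(32 N m²/ε²))` once `N δ ≥ 8 m/ε`;
(Q) all sample quantiles at once: the probability that some empirical quantile `q̂_N(u)`, `u ∈ (η, 1 − η)`, falls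
    outside `[q_π(u − η), q_π(u + η)]` is `≤ 4 (⌈2/η⌉ + 1) exp(−(N η − 16 m/ε)²/(128 N m²/ε²))` once `N η ≥ 16 m/ε`.

THIS FILE applies (H), (E), (Q) to the Doeblin CERTIFICATES of GEN-23, i.e. to the engine's update paths AS RUN on
`SU(N)` (any `β`; `L ≥ 2` where a sweep is involved).  The constants `m, ε′` are those of the certificate
(existential here: the files `SUNJitteredHMCCertificates`, `SUNMetropolisORSweepFiguresOfMerit`,
`CabibboMarinariORSweepFiguresOfMerit`, `SUNLeapfrogHMCORSweepFiguresOfMerit` produce them from the force / Boltzmann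
bounds), so what is certified is the SHAPE of the finite-`N` guarantee — Gaussian in `N` at rate `(ε′/m)²`, valid
from a cold or hot start without any burn-in assumption — not a number:

* §1 jittered `'hmc'` with one short atom: **`wilsonJitterHMC_timeAverage_tail_le`** (H),
  **`wilsonJitterHMC_edf_band`** (E), **`wilsonJitterHMC_quantiles_bracketed`** (Q);
* §2 jittered `'hmc'` + ANY exact step `P`: **`wilsonJitterHMC_exactStep_timeAverage_tail_le`** (H),
  **`wilsonJitterHMC_exactStep_edf_band`** (E);
* §3 DEFAULT fixed-step `'hmc'` + ANY exact step: **`wilson_sunLeapfrogHMCN_exactStep_timeAverage_tail_le`** (H);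
* §4 `'metro' + n_or × 'or'`: **`wilson_sunMetropolis_orSweep_timeAverage_tail_le`** (H),
  **`wilson_sunMetropolis_orSweep_quantiles_bracketed`** (Q);
* §5 CM `'hb' + n_or × 'or'` (ONE-STEP certificate, `m = 1`): **`wilson_cmSweep_orSweep_timeAverage_tail_le`** (H),
  **`wilson_cmSweep_orSweep_edf_band`** (E).

NOT CLAIMED: any value of `ε′`, `m`; optimality of the constants `4, 8, 16, 32, 128`; the capped heat-bath loops.
-/

noncomputable section

namespace Summit.Ventures.LatticeQCDFlow.Exactness

open MeasureTheory ProbabilityTheory ProbabilityTheory.Kernel Set Function Filter Topology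
open Literature.MathematicalPhysics.QuantumFieldTheory
open Literature.MathematicalPhysics.QuantumLattice (fundamentalRep continuous_fundamentalRep connectedSpace_specialUnitaryGroup)
open Summit.Ventures.LatticeQCDFlow.Scoring.GlivenkoCantelli
open scoped ENNReal Matrix Matrix.Norms.Operator NNReal

/-! ## §1 The jittered `'hmc'` path with one short atom -/

section Jittered

variable {N d L : ℕ} [NeZero N] [NeZero L] (β : ℝ)
variable {Lab : Type*} [Countable Lab] [MeasurableSpace Lab] [MeasurableSingletonClass Lab]

/-- **(H) HOEFFDING TAIL FOR TIME AVERAGES OF THE JITTERED ENGINE HMC, FROM EVERY START**: there is `τ₀ > 0`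
(depending on `N, d, L, β` only) such that whenever one atom `l₀` of the jitter law has `1 ≤ nstep l₀`,
`η {l₀} ≠ 0`, `0 < τ l₀ ≤ τ₀`, there are `m > 0` and `0 < ε′ ≤ 1` with: for every bounded measurable `f`
(`|f| ≤ C`), every initial law `μ₀`, every `N ≠ 0` and every `s` with `N s ≥ 4 m (C + |π f|)/ε′`,
`P_{μ₀}(s ≤ |A_N f − π f|) ≤ 2 exp(−(N s − 4 m (C + |π f|)/ε′)² / (8 N m² (C + |π f|)²/ε′²))`. -/
theorem wilsonJitterHMC_timeAverage_tail_le :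
    ∃ τ₀ : ℝ, 0 < τ₀ ∧ ∀ (nstep : Lab → ℕ) (τ : Lab → ℝ) (η : Measure Lab) [IsProbabilityMeasure η] (l₀ : Lab),
      1 ≤ nstep l₀ → η {l₀} ≠ 0 → 0 < τ l₀ → τ l₀ ≤ τ₀ →
      ∃ m : ℕ, ∃ ε' : ℝ≥0∞, 0 < m ∧ 0 < ε' ∧ ε' ≤ 1 ∧
      ∀ (f : GaugeConfig d L (Matrix.specialUnitaryGroup (Fin N) ℂ) → ℝ), Measurable f → ∀ C : ℝ, (∀ U, |f U| ≤ C) →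
      ∀ (μ₀ : Measure (GaugeConfig d L (Matrix.specialUnitaryGroup (Fin N) ℂ))) [IsProbabilityMeasure μ₀] (n : ℕ), n ≠ 0 →
      ∀ s : ℝ, 4 * m * (C + |∫ z, f z ∂(wilsonMeasure (d := d) (L := L) (fundamentalRep (Fin N)) (β / N))|) / ε'.toReal ≤ n * s →
        (Kernel.trajMeasure (X := fun _ : ℕ => GaugeConfig d L (Matrix.specialUnitaryGroup (Fin N) ℂ)) μ₀
              (fun k : ℕ => (wilsonJitterHMC N d L β nstep τ η).comap
                (fun h : (i : ↥(Finset.Iic k)) → GaugeConfig d L (Matrix.specialUnitaryGroup (Fin N) ℂ) =>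
                  h ⟨k, Finset.mem_Iic.2 le_rfl⟩) (measurable_pi_apply _))).real
            {x | s ≤ |(∑ i ∈ Finset.range n, f (x i)) / n
                - ∫ z, f z ∂(wilsonMeasure (d := d) (L := L) (fundamentalRep (Fin N)) (β / N))|}
          ≤ 2 * Real.exp (-(n * s - 4 * m * (C + |∫ z, f z ∂(wilsonMeasure (d := d) (L := L) (fundamentalRep (Fin N)) (β / N))|)
                / ε'.toReal) ^ 2
              / (8 * n * (m : ℝ) ^ 2 * (C + |∫ z, f z ∂(wilsonMeasure (d := d) (L := L) (fundamentalRep (Fin N)) (β / N))|) ^ 2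
                / ε'.toReal ^ 2)) := by
  obtain ⟨τ₀, hτ₀, h⟩ := wilsonJitterHMC_certificate (N := N) (d := d) (L := L) (Lab := Lab) β
  refine ⟨τ₀, hτ₀, fun nstep τ η _ l₀ hn hl₀ hτl hτl₀ => ?_⟩
  obtain ⟨m, ε', hm, hε0, hε1, hmin⟩ := h nstep τ η l₀ hn hl₀ hτl hτl₀
  refine ⟨m, ε', hm, hε0, hε1, fun f hf C hC μ₀ _ n hn0 s hs => ?_⟩
  exact chain_abs_tail_le_exp_of_nHit_minorised (μ₀ := μ₀)
    (wilsonJitterHMC_invariant (N := N) (d := d) (L := L) β nstep τ η)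
    (GeneralNCMC.minorised_setwise hmin) hm hε0 hε1 hf hC hn0 hs

/-- **(E) UNIFORM EDF BAND FOR ANY REAL OBSERVABLE OF THE JITTERED ENGINE HMC, FROM EVERY START**: same `τ₀`,
`m`, `ε′`; `O` measurable (the plaquette, a Polyakov loop, the topological charge — atoms allowed), grid `K ≥ 1`,
`δ > 0`, `N ≠ 0`, `N δ ≥ 8 m/ε′`:
`P_{μ₀}(∃ t, δ + 1/K ≤ |F_π(t) − F̂_N(t)|) ≤ 4 (K + 1) exp(−(N δ − 8 m/ε′)²/(32 N m²/ε′²))`. -/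
theorem wilsonJitterHMC_edf_band :
    ∃ τ₀ : ℝ, 0 < τ₀ ∧ ∀ (nstep : Lab → ℕ) (τ : Lab → ℝ) (η : Measure Lab) [IsProbabilityMeasure η] (l₀ : Lab),
      1 ≤ nstep l₀ → η {l₀} ≠ 0 → 0 < τ l₀ → τ l₀ ≤ τ₀ →
      ∃ m : ℕ, ∃ ε' : ℝ≥0∞, 0 < m ∧ 0 < ε' ∧ ε' ≤ 1 ∧
      ∀ (O : GaugeConfig d L (Matrix.specialUnitaryGroup (Fin N) ℂ) → ℝ), Measurable O →
      ∀ (μ₀ : Measure (GaugeConfig d L (Matrix.specialUnitaryGroup (Fin N) ℂ))) [IsProbabilityMeasure μ₀]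
        (K : ℕ), 1 ≤ K → ∀ (n : ℕ), n ≠ 0 → ∀ δ : ℝ, 0 < δ → 8 * m / ε'.toReal ≤ n * δ →
        (Kernel.trajMeasure (X := fun _ : ℕ => GaugeConfig d L (Matrix.specialUnitaryGroup (Fin N) ℂ)) μ₀
              (fun k : ℕ => (wilsonJitterHMC N d L β nstep τ η).comap
                (fun h : (i : ↥(Finset.Iic k)) → GaugeConfig d L (Matrix.specialUnitaryGroup (Fin N) ℂ) =>
                  h ⟨k, Finset.mem_Iic.2 le_rfl⟩) (measurable_pi_apply _))).real
            {x | ∃ t : ℝ, δ + 1 / K ≤ |cdf ((wilsonMeasure (d := d) (L := L) (fundamentalRep (Fin N)) (β / N)).map O) t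
                - (∑ i ∈ Finset.range n, (Set.Iic t).indicator (1 : ℝ → ℝ) (O (x i))) / n|}
          ≤ 4 * ((K : ℝ) + 1) * Real.exp (-(n * δ - 8 * m / ε'.toReal) ^ 2 / (32 * n * (m : ℝ) ^ 2 / ε'.toReal ^ 2)) := by
  obtain ⟨τ₀, hτ₀, h⟩ := wilsonJitterHMC_certificate (N := N) (d := d) (L := L) (Lab := Lab) β
  refine ⟨τ₀, hτ₀, fun nstep τ η _ l₀ hn hl₀ hτl hτl₀ => ?_⟩
  obtain ⟨m, ε', hm, hε0, hε1, hmin⟩ := h nstep τ η l₀ hn hl₀ hτl hτl₀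
  refine ⟨m, ε', hm, hε0, hε1, fun O hO μ₀ _ K hK n hn0 δ hδ0 hδ => ?_⟩
  exact minorised_measureReal_exists_edf_dev_ge_le (μ₀ := μ₀)
    (wilsonJitterHMC_invariant (N := N) (d := d) (L := L) β nstep τ η)
    (GeneralNCMC.minorised_setwise hmin) hm hε0 hε1 hO hK hn0 hδ0 hδ

/-- **(Q) ALL SAMPLE QUANTILES OF ANY REAL OBSERVABLE OF THE JITTERED ENGINE HMC AT ONCE, FROM EVERY START**: same
`τ₀`, `m`, `ε′`; `O` measurable, `η > 0`, `N ≠ 0`, `N η ≥ 16 m/ε′`: the probability that some empirical quantile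
`q̂_N(u)`, `u ∈ (η, 1 − η)`, falls outside `[q_π(u − η), q_π(u + η)]` is
`≤ 4 (⌈2/η⌉ + 1) exp(−(N η − 16 m/ε′)²/(128 N m²/ε′²))`. -/
theorem wilsonJitterHMC_quantiles_bracketed :
    ∃ τ₀ : ℝ, 0 < τ₀ ∧ ∀ (nstep : Lab → ℕ) (τ : Lab → ℝ) (η : Measure Lab) [IsProbabilityMeasure η] (l₀ : Lab),
      1 ≤ nstep l₀ → η {l₀} ≠ 0 → 0 < τ l₀ → τ l₀ ≤ τ₀ →
      ∃ m : ℕ, ∃ ε' : ℝ≥0∞, 0 < m ∧ 0 < ε' ∧ ε' ≤ 1 ∧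
      ∀ (O : GaugeConfig d L (Matrix.specialUnitaryGroup (Fin N) ℂ) → ℝ), Measurable O →
      ∀ (μ₀ : Measure (GaugeConfig d L (Matrix.specialUnitaryGroup (Fin N) ℂ))) [IsProbabilityMeasure μ₀]
        (n : ℕ), n ≠ 0 → ∀ θ : ℝ, 0 < θ → 16 * m / ε'.toReal ≤ n * θ →
        (Kernel.trajMeasure (X := fun _ : ℕ => GaugeConfig d L (Matrix.specialUnitaryGroup (Fin N) ℂ)) μ₀
              (fun k : ℕ => (wilsonJitterHMC N d L β nstep τ η).comap
                (fun h : (i : ↥(Finset.Iic k)) → GaugeConfig d L (Matrix.specialUnitaryGroup (Fin N) ℂ) =>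
                  h ⟨k, Finset.mem_Iic.2 le_rfl⟩) (measurable_pi_apply _))).real
            {x | ∃ u : ℝ, θ < u ∧ u + θ < 1 ∧
              ¬ (sInf {y | u - θ ≤ cdf ((wilsonMeasure (d := d) (L := L) (fundamentalRep (Fin N)) (β / N)).map O) y}
                    ≤ sInf {y | u ≤ cdf (((n : ℝ≥0∞)⁻¹) • ∑ i ∈ Finset.range n, Measure.dirac (O (x i))) y}
                  ∧ sInf {y | u ≤ cdf (((n : ℝ≥0∞)⁻¹) • ∑ i ∈ Finset.range n, Measure.dirac (O (x i))) y}
                    ≤ sInf {y | u + θ ≤ cdf ((wilsonMeasure (d := d) (L := L) (fundamentalRep (Fin N)) (β / N)).map O) y})}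
          ≤ 4 * ((⌈2 / θ⌉₊ : ℝ) + 1)
              * Real.exp (-(n * θ - 16 * m / ε'.toReal) ^ 2 / (128 * n * (m : ℝ) ^ 2 / ε'.toReal ^ 2)) := by
  obtain ⟨τ₀, hτ₀, h⟩ := wilsonJitterHMC_certificate (N := N) (d := d) (L := L) (Lab := Lab) β
  refine ⟨τ₀, hτ₀, fun nstep τ η _ l₀ hn hl₀ hτl hτl₀ => ?_⟩
  obtain ⟨m, ε', hm, hε0, hε1, hmin⟩ := h nstep τ η l₀ hn hl₀ hτl hτl₀
  refine ⟨m, ε', hm, hε0, hε1, fun O hO μ₀ _ n hn0 θ hθ hnθ => ?_⟩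
  exact minorised_measureReal_exists_quantile_unbracketed_le (μ₀ := μ₀)
    (wilsonJitterHMC_invariant (N := N) (d := d) (L := L) β nstep τ η)
    (GeneralNCMC.minorised_setwise hmin) hm hε0 hε1 hO hn0 hθ hnθ

/-! ## §2 The jittered `'hmc'` path followed by ANY exact step -/

/-- **(H) FOR THE COMPOSITE `P ∘ K_jit`** — `P` ANY Markov kernel leaving `wilsonMeasure (β/N)` invariant; same shape,
from every start. -/
theorem wilsonJitterHMC_exactStep_timeAverage_tail_le :
    ∃ τ₀ : ℝ, 0 < τ₀ ∧ ∀ (nstep : Lab → ℕ) (τ : Lab → ℝ) (η : Measure Lab) [IsProbabilityMeasure η] (l₀ : Lab),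
      1 ≤ nstep l₀ → η {l₀} ≠ 0 → 0 < τ l₀ → τ l₀ ≤ τ₀ →
      ∀ (P : Kernel (GaugeConfig d L (Matrix.specialUnitaryGroup (Fin N) ℂ)) (GaugeConfig d L (Matrix.specialUnitaryGroup (Fin N) ℂ)))
        [IsMarkovKernel P], Invariant P (wilsonMeasure (d := d) (L := L) (fundamentalRep (Fin N)) (β / N)) →
      ∃ m : ℕ, ∃ ε' : ℝ≥0∞, 0 < m ∧ 0 < ε' ∧ ε' ≤ 1 ∧
      ∀ (f : GaugeConfig d L (Matrix.specialUnitaryGroup (Fin N) ℂ) → ℝ), Measurable f → ∀ C : ℝ, (∀ U, |f U| ≤ C) →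
      ∀ (μ₀ : Measure (GaugeConfig d L (Matrix.specialUnitaryGroup (Fin N) ℂ))) [IsProbabilityMeasure μ₀] (n : ℕ), n ≠ 0 →
      ∀ s : ℝ, 4 * m * (C + |∫ z, f z ∂(wilsonMeasure (d := d) (L := L) (fundamentalRep (Fin N)) (β / N))|) / ε'.toReal ≤ n * s →
        (Kernel.trajMeasure (X := fun _ : ℕ => GaugeConfig d L (Matrix.specialUnitaryGroup (Fin N) ℂ)) μ₀
              (fun k : ℕ => (P ∘ₖ wilsonJitterHMC N d L β nstep τ η).comap
                (fun h : (i : ↥(Finset.Iic k)) → GaugeConfig d L (Matrix.specialUnitaryGroup (Fin N) ℂ) =>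
                  h ⟨k, Finset.mem_Iic.2 le_rfl⟩) (measurable_pi_apply _))).real
            {x | s ≤ |(∑ i ∈ Finset.range n, f (x i)) / n
                - ∫ z, f z ∂(wilsonMeasure (d := d) (L := L) (fundamentalRep (Fin N)) (β / N))|}
          ≤ 2 * Real.exp (-(n * s - 4 * m * (C + |∫ z, f z ∂(wilsonMeasure (d := d) (L := L) (fundamentalRep (Fin N)) (β / N))|)
                / ε'.toReal) ^ 2
              / (8 * n * (m : ℝ) ^ 2 * (C + |∫ z, f z ∂(wilsonMeasure (d := d) (L := L) (fundamentalRep (Fin N)) (β / N))|) ^ 2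
                / ε'.toReal ^ 2)) := by
  obtain ⟨τ₀, hτ₀, h⟩ := wilsonJitterHMC_exactStep_certificate (N := N) (d := d) (L := L) (Lab := Lab) β
  refine ⟨τ₀, hτ₀, fun nstep τ η _ l₀ hn hl₀ hτl hτl₀ P _ hP => ?_⟩
  obtain ⟨hinv, m, ε', hm, hε0, hε1, hmin⟩ := h nstep τ η l₀ hn hl₀ hτl hτl₀ P hP
  haveI := isMarkovKernel_wilsonJitterHMC (N := N) (d := d) (L := L) β nstep τ η
  refine ⟨m, ε', hm, hε0, hε1, fun f hf C hC μ₀ _ n hn0 s hs => ?_⟩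
  exact chain_abs_tail_le_exp_of_nHit_minorised (μ₀ := μ₀) hinv
    (GeneralNCMC.minorised_setwise hmin) hm hε0 hε1 hf hC hn0 hs

/-- **(E) FOR THE COMPOSITE `P ∘ K_jit`**: the uniform EDF band of any real observable, from every start. -/
theorem wilsonJitterHMC_exactStep_edf_band :
    ∃ τ₀ : ℝ, 0 < τ₀ ∧ ∀ (nstep : Lab → ℕ) (τ : Lab → ℝ) (η : Measure Lab) [IsProbabilityMeasure η] (l₀ : Lab),
      1 ≤ nstep l₀ → η {l₀} ≠ 0 → 0 < τ l₀ → τ l₀ ≤ τ₀ →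
      ∀ (P : Kernel (GaugeConfig d L (Matrix.specialUnitaryGroup (Fin N) ℂ)) (GaugeConfig d L (Matrix.specialUnitaryGroup (Fin N) ℂ)))
        [IsMarkovKernel P], Invariant P (wilsonMeasure (d := d) (L := L) (fundamentalRep (Fin N)) (β / N)) →
      ∃ m : ℕ, ∃ ε' : ℝ≥0∞, 0 < m ∧ 0 < ε' ∧ ε' ≤ 1 ∧
      ∀ (O : GaugeConfig d L (Matrix.specialUnitaryGroup (Fin N) ℂ) → ℝ), Measurable O →
      ∀ (μ₀ : Measure (GaugeConfig d L (Matrix.specialUnitaryGroup (Fin N) ℂ))) [IsProbabilityMeasure μ₀]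
        (K : ℕ), 1 ≤ K → ∀ (n : ℕ), n ≠ 0 → ∀ δ : ℝ, 0 < δ → 8 * m / ε'.toReal ≤ n * δ →
        (Kernel.trajMeasure (X := fun _ : ℕ => GaugeConfig d L (Matrix.specialUnitaryGroup (Fin N) ℂ)) μ₀
              (fun k : ℕ => (P ∘ₖ wilsonJitterHMC N d L β nstep τ η).comap
                (fun h : (i : ↥(Finset.Iic k)) → GaugeConfig d L (Matrix.specialUnitaryGroup (Fin N) ℂ) =>
                  h ⟨k, Finset.mem_Iic.2 le_rfl⟩) (measurable_pi_apply _))).real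
            {x | ∃ t : ℝ, δ + 1 / K ≤ |cdf ((wilsonMeasure (d := d) (L := L) (fundamentalRep (Fin N)) (β / N)).map O) t
                - (∑ i ∈ Finset.range n, (Set.Iic t).indicator (1 : ℝ → ℝ) (O (x i))) / n|}
          ≤ 4 * ((K : ℝ) + 1) * Real.exp (-(n * δ - 8 * m / ε'.toReal) ^ 2 / (32 * n * (m : ℝ) ^ 2 / ε'.toReal ^ 2)) := by
  obtain ⟨τ₀, hτ₀, h⟩ := wilsonJitterHMC_exactStep_certificate (N := N) (d := d) (L := L) (Lab := Lab) β
  refine ⟨τ₀, hτ₀, fun nstep τ η _ l₀ hn hl₀ hτl hτl₀ P _ hP => ?_⟩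
  obtain ⟨hinv, m, ε', hm, hε0, hε1, hmin⟩ := h nstep τ η l₀ hn hl₀ hτl hτl₀ P hP
  haveI := isMarkovKernel_wilsonJitterHMC (N := N) (d := d) (L := L) β nstep τ η
  refine ⟨m, ε', hm, hε0, hε1, fun O hO μ₀ _ K hK n hn0 δ hδ0 hδ => ?_⟩
  exact minorised_measureReal_exists_edf_dev_ge_le (μ₀ := μ₀) hinv
    (GeneralNCMC.minorised_setwise hmin) hm hε0 hε1 hO hK hn0 hδ0 hδ

end Jittered

/-! ## §3 The DEFAULT fixed-step `'hmc'` followed by ANY exact step -/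

section FixedStep

variable (N : ℕ) [NeZero N] {d L : ℕ} [NeZero L] (β : ℝ)

/-- **(H) FOR `P ∘ K_hmc` (FIXED STEP, `nstep · ε ≤ τ₀`)** — `P` ANY exact step; the Hoeffding tail of time averages
from every start, with the certificate's `m, ε′`. -/
theorem wilson_sunLeapfrogHMCN_exactStep_timeAverage_tail_le :
    ∃ τ₀ : ℝ, 0 < τ₀ ∧ ∀ (nstep : ℕ) (ε : ℝ), 1 ≤ nstep → 0 < ε → nstep * ε ≤ τ₀ →
      ∀ (P : Kernel (GaugeConfig d L (Matrix.specialUnitaryGroup (Fin N) ℂ)) (GaugeConfig d L (Matrix.specialUnitaryGroup (Fin N) ℂ)))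
        [IsMarkovKernel P], Invariant P (wilsonMeasure (d := d) (L := L) (fundamentalRep (Fin N)) (β / N)) →
      ∀ [IsMarkovKernel (sunLeapfrogHMCN (sunCoordι N) (sunCoordι_skew N) ε (Measure.addHaar : Measure (SUNCoords N))
                  (sunKinetic N) (measurable_halfKick_sun N (measurable_sunWilsonForceLaw_coeConfig N (d := d) (L := L) β) ε)
                  (fun U => β / N * wilsonAction (fundamentalRep (Fin N)) U) nstep)],
      ∃ m : ℕ, ∃ ε' : ℝ≥0∞, 0 < m ∧ 0 < ε' ∧ ε' ≤ 1 ∧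
      ∀ (f : GaugeConfig d L (Matrix.specialUnitaryGroup (Fin N) ℂ) → ℝ), Measurable f → ∀ C : ℝ, (∀ U, |f U| ≤ C) →
      ∀ (μ₀ : Measure (GaugeConfig d L (Matrix.specialUnitaryGroup (Fin N) ℂ))) [IsProbabilityMeasure μ₀] (n : ℕ), n ≠ 0 →
      ∀ s : ℝ, 4 * m * (C + |∫ z, f z ∂(wilsonMeasure (d := d) (L := L) (fundamentalRep (Fin N)) (β / N))|) / ε'.toReal ≤ n * s →
        (Kernel.trajMeasure (X := fun _ : ℕ => GaugeConfig d L (Matrix.specialUnitaryGroup (Fin N) ℂ)) μ₀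
              (fun k : ℕ => (P ∘ₖ (sunLeapfrogHMCN (sunCoordι N) (sunCoordι_skew N) ε (Measure.addHaar : Measure (SUNCoords N))
                  (sunKinetic N) (measurable_halfKick_sun N (measurable_sunWilsonForceLaw_coeConfig N (d := d) (L := L) β) ε)
                  (fun U => β / N * wilsonAction (fundamentalRep (Fin N)) U) nstep)).comap
                (fun h : (i : ↥(Finset.Iic k)) → GaugeConfig d L (Matrix.specialUnitaryGroup (Fin N) ℂ) =>
                  h ⟨k, Finset.mem_Iic.2 le_rfl⟩) (measurable_pi_apply _))).real
            {x | s ≤ |(∑ i ∈ Finset.range n, f (x i)) / n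
                - ∫ z, f z ∂(wilsonMeasure (d := d) (L := L) (fundamentalRep (Fin N)) (β / N))|}
          ≤ 2 * Real.exp (-(n * s - 4 * m * (C + |∫ z, f z ∂(wilsonMeasure (d := d) (L := L) (fundamentalRep (Fin N)) (β / N))|)
                / ε'.toReal) ^ 2
              / (8 * n * (m : ℝ) ^ 2 * (C + |∫ z, f z ∂(wilsonMeasure (d := d) (L := L) (fundamentalRep (Fin N)) (β / N))|) ^ 2
                / ε'.toReal ^ 2)) := by
  obtain ⟨τ₀, hτ₀, h⟩ := wilson_sunLeapfrogHMCN_exactStep_certificate N (d := d) (L := L) β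
  refine ⟨τ₀, hτ₀, fun nstep ε hn hε hτ P _ hP _ => ?_⟩
  obtain ⟨hinv, m, ε', hm, hε0, hε1, hmin⟩ := h nstep ε hn hε hτ P hP
  refine ⟨m, ε', hm, hε0, hε1, fun f hf C hC μ₀ _ n hn0 s hs => ?_⟩
  exact chain_abs_tail_le_exp_of_nHit_minorised (μ₀ := μ₀) hinv
    (GeneralNCMC.minorised_setwise hmin) hm hε0 hε1 hf hC hn0 hs

end FixedStep

/-! ## §4 `'metro' + n_or × 'or'` -/

section MetroOR

variable (N : ℕ) (s : ℝ) [Fact (0 < s)] [NeZero N]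
variable {d L : ℕ} {m : Type*} [Fintype m] [DecidableEq m]

/-- **(H) FOR `'metro' + n_or × 'or'`** (`L ≥ 2`, `nhit ≥ 1`, the link list visits every link, any OR schedule): the
Hoeffding tail of time averages from every start, with the certificate's `mm, ε′`. -/
theorem wilson_sunMetropolis_orSweep_timeAverage_tail_le [NeZero L] (hL : 2 ≤ L) (β : ℝ) {nhit : ℕ} (hn : 1 ≤ nhit)
    {Ls : List (Edge d L)} (hLs : ∀ e, e ∈ Ls) (sched : List (Edge d L × (Fin N ≃ Fin 2 ⊕ m)))
    [IsMarkovKernel (metropolisSweep (sunMetropolisKick N s)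
                (fun U : GaugeConfig d L (Matrix.specialUnitaryGroup (Fin N) ℂ) => Real.exp (-β * wilsonAction (suRep N) U)) nhit Ls)] :
    ∃ mm : ℕ, ∃ ε' : ℝ≥0∞, 0 < mm ∧ 0 < ε' ∧ ε' ≤ 1 ∧
      ∀ (f : GaugeConfig d L (Matrix.specialUnitaryGroup (Fin N) ℂ) → ℝ), Measurable f → ∀ C : ℝ, (∀ U, |f U| ≤ C) →
      ∀ (μ₀ : Measure (GaugeConfig d L (Matrix.specialUnitaryGroup (Fin N) ℂ))) [IsProbabilityMeasure μ₀] (n : ℕ), n ≠ 0 →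
      ∀ r : ℝ, 4 * mm * (C + |∫ z, f z ∂(wilsonMeasure (d := d) (L := L) (suRep N) β)|) / ε'.toReal ≤ n * r →
        (Kernel.trajMeasure (X := fun _ : ℕ => GaugeConfig d L (Matrix.specialUnitaryGroup (Fin N) ℂ)) μ₀
              (fun k : ℕ => (cmORSweep sched ∘ₖ metropolisSweep (sunMetropolisKick N s)
                (fun U : GaugeConfig d L (Matrix.specialUnitaryGroup (Fin N) ℂ) => Real.exp (-β * wilsonAction (suRep N) U)) nhit Ls).comap
                (fun h : (i : ↥(Finset.Iic k)) → GaugeConfig d L (Matrix.specialUnitaryGroup (Fin N) ℂ) =>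
                  h ⟨k, Finset.mem_Iic.2 le_rfl⟩) (measurable_pi_apply _))).real
            {x | r ≤ |(∑ i ∈ Finset.range n, f (x i)) / n - ∫ z, f z ∂(wilsonMeasure (d := d) (L := L) (suRep N) β)|}
          ≤ 2 * Real.exp (-(n * r - 4 * mm * (C + |∫ z, f z ∂(wilsonMeasure (d := d) (L := L) (suRep N) β)|) / ε'.toReal) ^ 2
              / (8 * n * (mm : ℝ) ^ 2 * (C + |∫ z, f z ∂(wilsonMeasure (d := d) (L := L) (suRep N) β)|) ^ 2 / ε'.toReal ^ 2)) := by
  haveI := isProbabilityMeasure_wilsonMeasure_suRep N (d := d) (L := L) β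
  obtain ⟨hinv, mm, ε', hmm, hε0, hε1, hmin⟩ :=
    wilson_sunMetropolis_orSweep_certificate N s (d := d) hL β hn hLs sched
  refine ⟨mm, ε', hmm, hε0, hε1, fun f hf C hC μ₀ _ n hn0 r hr => ?_⟩
  exact chain_abs_tail_le_exp_of_nHit_minorised (μ₀ := μ₀) hinv
    (GeneralNCMC.minorised_setwise hmin) hmm hε0 hε1 hf hC hn0 hr

/-- **(Q) FOR `'metro' + n_or × 'or'`**: all sample quantiles of any real observable bracketed at once, from every
start (`θ > 0`, `N ≠ 0`, `N θ ≥ 16 mm/ε′`). -/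
theorem wilson_sunMetropolis_orSweep_quantiles_bracketed [NeZero L] (hL : 2 ≤ L) (β : ℝ) {nhit : ℕ} (hn : 1 ≤ nhit)
    {Ls : List (Edge d L)} (hLs : ∀ e, e ∈ Ls) (sched : List (Edge d L × (Fin N ≃ Fin 2 ⊕ m)))
    [IsMarkovKernel (metropolisSweep (sunMetropolisKick N s)
                (fun U : GaugeConfig d L (Matrix.specialUnitaryGroup (Fin N) ℂ) => Real.exp (-β * wilsonAction (suRep N) U)) nhit Ls)] :
    ∃ mm : ℕ, ∃ ε' : ℝ≥0∞, 0 < mm ∧ 0 < ε' ∧ ε' ≤ 1 ∧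
      ∀ (O : GaugeConfig d L (Matrix.specialUnitaryGroup (Fin N) ℂ) → ℝ), Measurable O →
      ∀ (μ₀ : Measure (GaugeConfig d L (Matrix.specialUnitaryGroup (Fin N) ℂ))) [IsProbabilityMeasure μ₀]
        (n : ℕ), n ≠ 0 → ∀ θ : ℝ, 0 < θ → 16 * mm / ε'.toReal ≤ n * θ →
        (Kernel.trajMeasure (X := fun _ : ℕ => GaugeConfig d L (Matrix.specialUnitaryGroup (Fin N) ℂ)) μ₀
              (fun k : ℕ => (cmORSweep sched ∘ₖ metropolisSweep (sunMetropolisKick N s)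
                (fun U : GaugeConfig d L (Matrix.specialUnitaryGroup (Fin N) ℂ) => Real.exp (-β * wilsonAction (suRep N) U)) nhit Ls).comap
                (fun h : (i : ↥(Finset.Iic k)) → GaugeConfig d L (Matrix.specialUnitaryGroup (Fin N) ℂ) =>
                  h ⟨k, Finset.mem_Iic.2 le_rfl⟩) (measurable_pi_apply _))).real
            {x | ∃ u : ℝ, θ < u ∧ u + θ < 1 ∧
              ¬ (sInf {y | u - θ ≤ cdf ((wilsonMeasure (d := d) (L := L) (suRep N) β).map O) y}
                    ≤ sInf {y | u ≤ cdf (((n : ℝ≥0∞)⁻¹) • ∑ i ∈ Finset.range n, Measure.dirac (O (x i))) y}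
                  ∧ sInf {y | u ≤ cdf (((n : ℝ≥0∞)⁻¹) • ∑ i ∈ Finset.range n, Measure.dirac (O (x i))) y}
                    ≤ sInf {y | u + θ ≤ cdf ((wilsonMeasure (d := d) (L := L) (suRep N) β).map O) y})}
          ≤ 4 * ((⌈2 / θ⌉₊ : ℝ) + 1)
              * Real.exp (-(n * θ - 16 * mm / ε'.toReal) ^ 2 / (128 * n * (mm : ℝ) ^ 2 / ε'.toReal ^ 2)) := by
  haveI := isProbabilityMeasure_wilsonMeasure_suRep N (d := d) (L := L) β
  obtain ⟨hinv, mm, ε', hmm, hε0, hε1, hmin⟩ :=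
    wilson_sunMetropolis_orSweep_certificate N s (d := d) hL β hn hLs sched
  refine ⟨mm, ε', hmm, hε0, hε1, fun O hO μ₀ _ n hn0 θ hθ hnθ => ?_⟩
  exact minorised_measureReal_exists_quantile_unbracketed_le (μ₀ := μ₀) hinv
    (GeneralNCMC.minorised_setwise hmin) hmm hε0 hε1 hO hn0 hθ hnθ

end MetroOR

/-! ## §5 CM `'hb' + n_or × 'or'` (one-step certificate, `m = 1`) -/

section CMOR

variable (N : ℕ) [NeZero N] {d L : ℕ} {m : Type*} [Fintype m] [DecidableEq m]

/-- **(H) FOR `'hb' + n_or × 'or'`** (`L ≥ 2`, lexicographic subgroup order or its reverse, every link visited, any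
OR schedule): with the ONE-STEP certificate (`m = 1`), for `|f| ≤ C`, every start, `N ≠ 0`,
`N s ≥ 4 (C + |π f|)/ε′`: `P_{μ₀}(s ≤ |A_N f − π f|) ≤ 2 exp(−(N s − 4 (C + |π f|)/ε′)²/(8 N (C + |π f|)²/ε′²))`. -/
theorem wilson_cmSweep_orSweep_timeAverage_tail_le [NeZero L] (hL : 2 ≤ L) (β : ℝ) (frames : List (Fin N ≃ Fin 2 ⊕ m))
    (hlex : frames.map pairOf = lexPairs (Finset.univ.sort (· ≤ ·) : List (Fin N)) ∨
      frames.map pairOf = (lexPairs (Finset.univ.sort (· ≤ ·) : List (Fin N))).reverse)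
    {links : List (Edge d L)} (hl : ∀ e, e ∈ links) (sched : List (Edge d L × (Fin N ≃ Fin 2 ⊕ m)))
    [IsMarkovKernel (latSweep (gibbsDensity fun U : GaugeConfig d L (Matrix.specialUnitaryGroup (Fin N) ℂ) => β * wilsonAction (suRep N) U) frames links)] :
    ∃ ε' : ℝ≥0∞, 0 < ε' ∧ ε' ≤ 1 ∧
      ∀ (f : GaugeConfig d L (Matrix.specialUnitaryGroup (Fin N) ℂ) → ℝ), Measurable f → ∀ C : ℝ, (∀ U, |f U| ≤ C) →
      ∀ (μ₀ : Measure (GaugeConfig d L (Matrix.specialUnitaryGroup (Fin N) ℂ))) [IsProbabilityMeasure μ₀] (n : ℕ), n ≠ 0 →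
      ∀ r : ℝ, 4 * (C + |∫ z, f z ∂(wilsonMeasure (d := d) (L := L) (suRep N) β)|) / ε'.toReal ≤ n * r →
        (Kernel.trajMeasure (X := fun _ : ℕ => GaugeConfig d L (Matrix.specialUnitaryGroup (Fin N) ℂ)) μ₀
              (fun k : ℕ => (cmORSweep sched ∘ₖ
                latSweep (gibbsDensity fun U : GaugeConfig d L (Matrix.specialUnitaryGroup (Fin N) ℂ) => β * wilsonAction (suRep N) U) frames links).comap
                (fun h : (i : ↥(Finset.Iic k)) → GaugeConfig d L (Matrix.specialUnitaryGroup (Fin N) ℂ) =>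
                  h ⟨k, Finset.mem_Iic.2 le_rfl⟩) (measurable_pi_apply _))).real
            {x | r ≤ |(∑ i ∈ Finset.range n, f (x i)) / n - ∫ z, f z ∂(wilsonMeasure (d := d) (L := L) (suRep N) β)|}
          ≤ 2 * Real.exp (-(n * r - 4 * (C + |∫ z, f z ∂(wilsonMeasure (d := d) (L := L) (suRep N) β)|) / ε'.toReal) ^ 2
              / (8 * n * (C + |∫ z, f z ∂(wilsonMeasure (d := d) (L := L) (suRep N) β)|) ^ 2 / ε'.toReal ^ 2)) := by
  haveI : IsProbabilityMeasure (wilsonMeasure (d := d) (L := L) (suRep N) β) := isProbabilityMeasure_wilsonMeasure _ continuous_suRep β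
  obtain ⟨hinv, ε', hε0, hε1, hmin⟩ := wilson_cmSweep_orSweep_certificate N (d := d) hL β frames hlex hl sched
  refine ⟨ε', hε0, hε1, fun f hf C hC μ₀ _ n hn0 r hr => ?_⟩
  have h := chain_abs_tail_le_exp_of_nHit_minorised (μ₀ := μ₀) hinv
    (GeneralNCMC.minorised_setwise hmin) Nat.one_pos hε0 hε1 hf hC hn0 (s := r)
    (by simpa only [Nat.cast_one, mul_one] using hr)
  simpa only [Nat.cast_one, mul_one, one_pow] using h

/-- **(E) FOR `'hb' + n_or × 'or'`**: the uniform EDF band of any real observable from every start, one-step certificate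
(`K ≥ 1`, `δ > 0`, `N ≠ 0`, `N δ ≥ 8/ε′`). -/
theorem wilson_cmSweep_orSweep_edf_band [NeZero L] (hL : 2 ≤ L) (β : ℝ) (frames : List (Fin N ≃ Fin 2 ⊕ m))
    (hlex : frames.map pairOf = lexPairs (Finset.univ.sort (· ≤ ·) : List (Fin N)) ∨
      frames.map pairOf = (lexPairs (Finset.univ.sort (· ≤ ·) : List (Fin N))).reverse)
    {links : List (Edge d L)} (hl : ∀ e, e ∈ links) (sched : List (Edge d L × (Fin N ≃ Fin 2 ⊕ m)))
    [IsMarkovKernel (latSweep (gibbsDensity fun U : GaugeConfig d L (Matrix.specialUnitaryGroup (Fin N) ℂ) => β * wilsonAction (suRep N) U) frames links)] :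
    ∃ ε' : ℝ≥0∞, 0 < ε' ∧ ε' ≤ 1 ∧
      ∀ (O : GaugeConfig d L (Matrix.specialUnitaryGroup (Fin N) ℂ) → ℝ), Measurable O →
      ∀ (μ₀ : Measure (GaugeConfig d L (Matrix.specialUnitaryGroup (Fin N) ℂ))) [IsProbabilityMeasure μ₀]
        (K : ℕ), 1 ≤ K → ∀ (n : ℕ), n ≠ 0 → ∀ δ : ℝ, 0 < δ → 8 / ε'.toReal ≤ n * δ →
        (Kernel.trajMeasure (X := fun _ : ℕ => GaugeConfig d L (Matrix.specialUnitaryGroup (Fin N) ℂ)) μ₀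
              (fun k : ℕ => (cmORSweep sched ∘ₖ
                latSweep (gibbsDensity fun U : GaugeConfig d L (Matrix.specialUnitaryGroup (Fin N) ℂ) => β * wilsonAction (suRep N) U) frames links).comap
                (fun h : (i : ↥(Finset.Iic k)) → GaugeConfig d L (Matrix.specialUnitaryGroup (Fin N) ℂ) =>
                  h ⟨k, Finset.mem_Iic.2 le_rfl⟩) (measurable_pi_apply _))).real
            {x | ∃ t : ℝ, δ + 1 / K ≤ |cdf ((wilsonMeasure (d := d) (L := L) (suRep N) β).map O) t
                - (∑ i ∈ Finset.range n, (Set.Iic t).indicator (1 : ℝ → ℝ) (O (x i))) / n|}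
          ≤ 4 * ((K : ℝ) + 1) * Real.exp (-(n * δ - 8 / ε'.toReal) ^ 2 / (32 * n / ε'.toReal ^ 2)) := by
  haveI : IsProbabilityMeasure (wilsonMeasure (d := d) (L := L) (suRep N) β) := isProbabilityMeasure_wilsonMeasure _ continuous_suRep β
  obtain ⟨hinv, ε', hε0, hε1, hmin⟩ := wilson_cmSweep_orSweep_certificate N (d := d) hL β frames hlex hl sched
  refine ⟨ε', hε0, hε1, fun O hO μ₀ _ K hK n hn0 δ hδ0 hδ => ?_⟩
  have h := minorised_measureReal_exists_edf_dev_ge_le (μ₀ := μ₀) hinv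
    (GeneralNCMC.minorised_setwise hmin) Nat.one_pos hε0 hε1 hO hK hn0 hδ0
    (by simpa only [Nat.cast_one, mul_one] using hδ)
  simpa only [Nat.cast_one, mul_one, one_pow] using h

end CMOR

end Summit.Ventures.LatticeQCDFlow.Exactness

end
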